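import Literature.NumberTheory.Automorphic.InvolutionRingFixedDecomposition      -- ★ `HeisRing.fixedPart ∕ skewPart ∕ ringDecomp ∕ smulFixed ∕ smulSkew ∕ fixedModulus ∕ skewModulus`, `χ⁺ = χ⁻`, `χ⁻ = √‖·‖`
import Summits.HodgeConjecture.HodgeConjecture.Theorems.F0P3cStCharTSModulusShellCharacterVanishing   -- ★ B2 (ii) (this seat): `d×b` invariance, the vanishing; brings ★ B1
import Summits.HodgeConjecture.HodgeConjecture.Theorems.F0P3cStCharTSInvolutionRingPolarSliceShells     -- ★ B2 (i) FILE 1 (this seat): substitution on `R⁻`, `ν⁺`-shells on `R⁺`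
import Mathlib.MeasureTheory.Integral.Prod
import HarnessLib

/-!
# F0 · P3c · line LH6 «StCharTS» — «INVOLUTION-RING POLAR SLICE★» FILE 2 «SLICE» (ROAD «KEYS3-ANALYTIC», LEAD T15-03; brick B2 (i)+(iii) of MEMO v3): over a locally compact commutative ring `R`
# with an involution `σ` and `2 ∈ Rˣ`, the `d×b`-integral of a fixed-unit-invariant `h` over a modulus annulus SLICES along `b = s·(1+η)` (`s ∈ R⁺`, `η ∈ R⁻`) into
# (a constant) × `J_h := ∫_{R⁻} h(1+η) ‖1+η‖⁻¹ dη`; with B2 (ii) («the annulus integral vanishes») this gives **`J_h = 0`** [TateThesis1967 §2; WeilBNT1967 VII §2; Keys1984 §7]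

Cell `pub/hodgecm-mathlib`, crux H413 = `stmt-HodgeConjecture-24833` (lane `--supports … --as helper`), route HCCMUnconditional; seat F0P2-p06 (g21), ROAD «KEYS3-ANALYTIC» (LEAD
F0P3a-plan (g16) T15-03 «GO», fenced; MEMO `F0/P2/F0P2-p06/g21/MEMO-KEYS3-analytic-road.v3` §3).  THEOREMS ONLY (0 def ∕ 0 instance ∕ 0 notation ∕ 0 sorry).  FRAME = ★
`InvolutionRingFixedDecomposition` (`R` commutative, locally compact Hausdorff second countable, Borel; `σ : R →+* R` continuous involution; `[Invertible (2 : R)]`; a `σ`-skew unit `δ`)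
+ the «norm» `nrm : R → ℝ≥0` of ★ B2 (ii) (`nrm (u b) = ‖u‖_R nrm b`, `nrm 1 = 1`, measurable).  No field, no valuation, no residue characteristic in any STATEMENT (T15-03 (k1)).
-/

set_option autoImplicit false
-- the mandated namespace has the single-problem summit's repeated segment (`HodgeConjecture.HodgeConjecture`)
set_option linter.dupNamespace false

noncomputable section

open MeasureTheory Set
open scoped Pointwise NNReal ENNReal
open Literature.NumberTheory.Automorphic.UnitaryGroup.HeisRing
open Summit.HodgeConjecture.HodgeConjecture.Cruxes.H413.F0P3cStCharTSHeightShellFundamentalDomain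
open Summit.HodgeConjecture.HodgeConjecture.Cruxes.H413.F0P3cStCharTSModulusShellCharacterVanishing
open Summit.HodgeConjecture.HodgeConjecture.Cruxes.H413.F0P3cStCharTSInvolutionRingPolarSliceShells

namespace Summit.HodgeConjecture.HodgeConjecture.Cruxes.H413.F0P3cStCharTSInvolutionRingPolarSlice

variable {R : Type*} [CommRing R] [TopologicalSpace R] [IsTopologicalRing R] [LocallyCompactSpace R] [T2Space R] [SecondCountableTopology R]
  [MeasurableSpace R] [BorelSpace R] (σ : R →+* R) (hσ : ∀ x, σ (σ x) = x) (hσc : Continuous σ) [Invertible (2 : R)]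

/-! ## §3 The polar slice `b = s · (1 + η)`: `∫_{annulus} (nrm b)⁻¹ • h b dμ_R = V' • J_h` -/

section Slice

variable (μp : Measure (fixedPart σ)) [μp.IsAddHaarMeasure] [μp.Regular] (μm : Measure (skewPart σ)) [μm.IsAddHaarMeasure] [μm.Regular]
  {nrm : R → ℝ≥0} (hnm : Measurable nrm) (hmul : ∀ (u : Rˣ) (b : R), nrm ((u : R) * b) = distribHaarChar R u * nrm b) (hone : nrm 1 = 1)

include hσ hnm hmul hone in
/-- **«INVOLUTION-RING POLAR SLICE».**  `μ_R := (μ⁺ ⊗ μ⁻) ∘ ringDecomp⁻¹` (a Haar measure of `R`), `Q = ‖l₀‖_R > 1` for a `σ`-fixed unit `l₀`, `1 + η ∈ Rˣ` for every `η ∈ R⁻`, `μ⁺`-a.e. `s ∈ R⁺` a unit,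
`h : R → E` measurable, bounded and invariant under `σ`-FIXED units, the ball `{nrm ≤ A}` compact.  Then the `d×b`-integral of `h` over the modulus annulus SLICES:
  `∫_{A/Q < nrm b ≤ A} (nrm b)⁻¹ • h b dμ_R = V' • ∫_{R⁻} (nrm (1+η))⁻¹ • h (1+η) dμ⁻(η)`,
`V' = ν⁺{A₀/Q < nrm s ≤ A₀}` the (shell-independent, §2) `ν⁺ = (√nrm)⁻¹ μ⁺`-mass of an `s`-shell.  Substitution `b = s + y`, `y = s·η` (Jacobian `χ⁻(s) = √‖s‖`, §1), Fubini, §2.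
[cite: TateThesis1967, §2.2–2.4] [cite: WeilBNT1967, Ch. VII §2] [cite: Keys1984, §7 Thm. (1)] -/
theorem setIntegral_modulusShell_eq_fixedShellMass_smul_skewLineIntegral
    {E : Type*} [NormedAddCommGroup E] [NormedSpace ℝ E] [CompleteSpace E] [SecondCountableTopology E] [MeasurableSpace E] [BorelSpace E]
    (δ : Rˣ) (hδ : σ (δ : R) = -δ) (l₀ : Rˣ) (hl₀ : σ (l₀ : R) = l₀) (hQ : 1 < distribHaarChar R l₀)
    (hη : ∀ η : skewPart σ, IsUnit (1 + (η : R))) (hunit : ∀ᵐ s ∂μp, IsUnit ((s : fixedPart σ) : R))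
    {A : ℝ} (hA : 0 < A) (hcpt : IsCompact {b : R | (nrm b : ℝ) ≤ A}) {A₀ : ℝ} (hA₀ : 0 < A₀)
    (h : R → E) (hhm : Measurable h) {C : ℝ} (hhb : ∀ b, ‖h b‖ ≤ C) (hhs : ∀ (s : Rˣ), σ (s : R) = s → ∀ b, h ((s : R) * b) = h b) :
    ∫ b in (fun b : R => (nrm b : ℝ)) ⁻¹' Set.Ioc (A / (distribHaarChar R l₀ : ℝ)) A, ((nrm b)⁻¹ : ℝ≥0) • h b
        ∂((μp.prod μm).map (ringDecomp σ hσ hσc).symm) =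
      ((μp.withDensity fun s => ((NNReal.sqrt (nrm (s : R)))⁻¹ : ℝ≥0))
          ((fun s : fixedPart σ => (nrm (s : R) : ℝ)) ⁻¹' Set.Ioc (A₀ / (distribHaarChar R l₀ : ℝ)) A₀)).toReal •
        ∫ η, ((nrm (1 + (η : R)))⁻¹ : ℝ≥0) • h (1 + (η : R)) ∂μm := by
  haveI := locallyCompactSpace_fixedPart σ hσc
  haveI := locallyCompactSpace_skewPart σ hσc
  haveI : SecondCountableTopology (fixedPart σ) := TopologicalSpace.Subtype.secondCountableTopology _
  haveI : SecondCountableTopology (skewPart σ) := TopologicalSpace.Subtype.secondCountableTopology _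
  -- notation
  set Q : ℝ≥0 := distribHaarChar R l₀ with hQdef
  have hQ0 : (0 : ℝ) < (Q : ℝ) := by exact_mod_cast lt_trans zero_lt_one hQ
  set e := ringDecomp σ hσ hσc with he
  set μR : Measure R := (μp.prod μm).map e.symm with hμR
  haveI : (μp.prod μm).IsAddHaarMeasure := inferInstance
  haveI : μR.IsAddHaarMeasure := ContinuousAddEquiv.isAddHaarMeasure_map (μp.prod μm) e.symm
  have hsymm : ∀ p : fixedPart σ × skewPart σ, e.symm p = (p.1 : R) + (p.2 : R) := fun p => rfl
  set S : Set R := (fun b : R => (nrm b : ℝ)) ⁻¹' Set.Ioc (A / (Q : ℝ)) A with hSdef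
  have hnmR : Measurable (fun b : R => (nrm b : ℝ)) := NNReal.continuous_coe.measurable.comp hnm
  have hS : MeasurableSet S := hnmR measurableSet_Ioc
  set Φ : R → E := fun b => ((nrm b)⁻¹ : ℝ≥0) • h b with hΦdef
  have hΦm : Measurable Φ := (hnm.inv.coe_nnreal_real).smul hhm
  set n1 : skewPart σ → ℝ≥0 := fun η => nrm (1 + (η : R)) with hn1def
  have hn1m : Measurable n1 := hnm.comp (measurable_const.add measurable_subtype_coe)
  have hn1pos : ∀ η, 0 < n1 η := fun η => nrm_pos_of_isUnit hmul hone (hη η)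
  set ψ : skewPart σ → E := fun η => ((n1 η)⁻¹ : ℝ≥0) • h (1 + (η : R)) with hψdef
  have hψm : Measurable ψ := (hn1m.inv.coe_nnreal_real).smul (hhm.comp (measurable_const.add measurable_subtype_coe))
  set dens : fixedPart σ → ℝ≥0 := fun s => (NNReal.sqrt (nrm (s : R)))⁻¹ with hdensdef
  have hnmp : Measurable (fun s : fixedPart σ => nrm (s : R)) := hnm.comp measurable_subtype_coe
  have hdensm : Measurable dens := (NNReal.continuous_sqrt.measurable.comp hnmp).inv
  set ν := μp.withDensity (fun s => (dens s : ℝ≥0∞)) with hνdef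
  -- the `s`-shells and their common mass `V'`
  set T : ℝ → Set (fixedPart σ) := fun A' => (fun s : fixedPart σ => (nrm (s : R) : ℝ)) ⁻¹' Set.Ioc (A' / (Q : ℝ)) A' with hTdef
  have hTm : ∀ A', MeasurableSet (T A') := fun A' => (NNReal.continuous_coe.measurable.comp hnmp) measurableSet_Ioc
  have hposp : ∀ᵐ s ∂μp, 0 < nrm ((s : fixedPart σ) : R) := hunit.mono fun s hs => nrm_pos_of_isUnit hmul hone hs
  have hV : ∀ A', 0 < A' → ν (T A') = ν (T A₀) := fun A' hA' =>
    withDensity_fixedShell_eq σ hσ hσc μp hnm hmul hone δ hδ l₀ hl₀ hQ hposp hA' hA₀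
  -- Step A: integrability of `𝟙_S Φ` for `μR`
  have hSfin : μR S < ⊤ := lt_of_le_of_lt (measure_mono fun b hb => hb.2) hcpt.measure_lt_top
  have hbound : ∀ b ∈ S, ‖Φ b‖ ≤ (Q : ℝ) / A * C := by
    intro b hb
    have hb1 : A / (Q : ℝ) < (nrm b : ℝ) := hb.1
    have hnb : 0 < (nrm b : ℝ) := lt_trans (div_pos hA hQ0) hb1
    have hC : 0 ≤ C := le_trans (norm_nonneg _) (hhb b)
    have hinv : ((nrm b : ℝ))⁻¹ ≤ (Q : ℝ) / A := by
      rw [inv_le_comm₀ hnb (div_pos hQ0 hA), inv_div]; exact hb1.le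
    change ‖((nrm b)⁻¹ : ℝ≥0) • h b‖ ≤ _
    rw [NNReal.smul_def, norm_smul, Real.norm_of_nonneg (NNReal.coe_nonneg _), NNReal.coe_inv]
    exact mul_le_mul hinv (hhb b) (norm_nonneg _) (le_of_lt (div_pos hQ0 hA))
  have hint : IntegrableOn Φ S μR :=
    Measure.integrableOn_of_bounded hSfin.ne hΦm.aestronglyMeasurable ((ae_restrict_iff' hS).2 (Filter.Eventually.of_forall hbound))
  have hintS : Integrable (S.indicator Φ) μR := (integrable_indicator_iff hS).2 hint
  -- Step B/C: to the product `R⁺ × R⁻` and Fubini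
  set meq : fixedPart σ × skewPart σ ≃ᵐ R := e.symm.toHomeomorph.toMeasurableEquiv with hmeq
  have hmeq_apply : ∀ p, meq p = (p.1 : R) + (p.2 : R) := fun p => rfl
  have hμR' : μR = (μp.prod μm).map meq := rfl
  have hintS' : Integrable (S.indicator Φ) ((μp.prod μm).map meq) := hintS
  have hintP : Integrable (fun p : fixedPart σ × skewPart σ => S.indicator Φ ((p.1 : R) + (p.2 : R))) (μp.prod μm) :=
    (integrable_map_equiv meq (S.indicator Φ)).1 hintS'
  have hLHS : ∫ b in S, Φ b ∂μR = ∫ s, ∫ y, S.indicator Φ ((s : R) + (y : R)) ∂μm ∂μp := by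
    calc ∫ b in S, Φ b ∂μR = ∫ b, S.indicator Φ b ∂μR := (integral_indicator hS).symm
      _ = ∫ p, S.indicator Φ (meq p) ∂(μp.prod μm) := by rw [hμR']; exact integral_map_equiv meq _
      _ = ∫ p, S.indicator Φ ((p.1 : R) + (p.2 : R)) ∂(μp.prod μm) := rfl
      _ = ∫ s, ∫ y, S.indicator Φ ((s : R) + (y : R)) ∂μm ∂μp := integral_prod _ hintP
  -- the swapped integrand `G(s, η) = 𝟙[s ∈ T(A / nrm(1+η))] (√nrm s)⁻¹ • ψ η`
  set K : Set (fixedPart σ × skewPart σ) := {p | p.1 ∈ T (A / (n1 p.2 : ℝ))} with hKdef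
  have hK : MeasurableSet K := by
    have h1 : Measurable fun p : fixedPart σ × skewPart σ => (nrm ((p.1 : fixedPart σ) : R) : ℝ) :=
      (NNReal.continuous_coe.measurable.comp hnmp).comp measurable_fst
    have h2 : Measurable fun p : fixedPart σ × skewPart σ => A / (n1 p.2 : ℝ) :=
      measurable_const.div ((NNReal.continuous_coe.measurable.comp hn1m).comp measurable_snd)
    have h3 : Measurable fun p : fixedPart σ × skewPart σ => A / (n1 p.2 : ℝ) / (Q : ℝ) := h2.div_const _
    have hK' : K = {p | A / (n1 p.2 : ℝ) / (Q : ℝ) < (nrm ((p.1 : fixedPart σ) : R) : ℝ)} ∩ {p | (nrm ((p.1 : fixedPart σ) : R) : ℝ) ≤ A / (n1 p.2 : ℝ)} := by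
      ext p; simp only [hKdef, hTdef, Set.mem_setOf_eq, Set.mem_preimage, Set.mem_Ioc, Set.mem_inter_iff]
    rw [hK']
    exact (measurableSet_lt h3 h1).inter (measurableSet_le h1 h2)
  set G : fixedPart σ × skewPart σ → E := fun p => (K.indicator (fun p => (dens p.1 : ℝ)) p) • ψ p.2 with hGdef
  have hGm : Measurable G :=
    (((NNReal.continuous_coe.measurable.comp hdensm).comp measurable_fst).indicator hK).smul (hψm.comp measurable_snd)
  -- Step D: the pointwise identity behind the fibrewise substitution `y = s η` at a unit `s`
  have hsfix : ∀ (s : fixedPart σ) (hs : IsUnit (s : R)), σ ((hs.unit : Rˣ) : R) = hs.unit := fun s hs => by rw [hs.unit_spec]; exact s.2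
  have hpt : ∀ (s : fixedPart σ) (hs : IsUnit (s : R)) (η : skewPart σ),
      (skewModulus σ hσc hs.unit (hsfix s hs) : ℝ) • S.indicator Φ ((s : R) + ((smulSkew σ hs.unit (hsfix s hs) η : skewPart σ) : R)) = G (s, η) := by
    intro s hs η
    have hprod : (s : R) + ((smulSkew σ hs.unit (hsfix s hs) η : skewPart σ) : R) = (s : R) * (1 + (η : R)) := by
      rw [coe_smulSkew, hs.unit_spec]; ring
    have hnprod : nrm ((s : R) * (1 + (η : R))) = nrm (s : R) * n1 η := nrm_mul_of_isUnit hmul hone hs _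
    have hn : (0 : ℝ) < (n1 η : ℝ) := by exact_mod_cast hn1pos η
    have hmem : ((s : R) * (1 + (η : R)) ∈ S) ↔ (s, η) ∈ K := by
      change (nrm ((s : R) * (1 + (η : R))) : ℝ) ∈ Set.Ioc (A / (Q : ℝ)) A ↔ (nrm (s : R) : ℝ) ∈ Set.Ioc (A / (n1 η : ℝ) / (Q : ℝ)) (A / (n1 η : ℝ))
      rw [hnprod, NNReal.coe_mul, Set.mem_Ioc, Set.mem_Ioc, div_right_comm, div_lt_iff₀ hn, le_div_iff₀ hn]
    have hh1 : h ((s : R) * (1 + (η : R))) = h (1 + (η : R)) := by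
      have := hhs hs.unit (hsfix s hs) (1 + (η : R)); rwa [hs.unit_spec] at this
    have hd : (skewModulus σ hσc hs.unit (hsfix s hs) : ℝ) * ((nrm (s : R) : ℝ))⁻¹ = (dens s : ℝ) := by
      have := skewModulus_mul_inv_nrm σ hσ hσc hmul hone δ hδ hs.unit (hsfix s hs)
      rw [hs.unit_spec] at this
      change _ = (((NNReal.sqrt (nrm (s : R)))⁻¹ : ℝ≥0) : ℝ)
      rw [← this, NNReal.coe_mul, NNReal.coe_inv]
    rw [hprod]
    by_cases hsK : (s, η) ∈ K
    · have hbS : (s : R) * (1 + (η : R)) ∈ S := hmem.2 hsK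
      rw [Set.indicator_of_mem hbS]
      change (skewModulus σ hσc hs.unit (hsfix s hs) : ℝ) • ((((nrm ((s : R) * (1 + (η : R))))⁻¹ : ℝ≥0)) • h ((s : R) * (1 + (η : R)))) =
        (K.indicator (fun p => (dens p.1 : ℝ)) (s, η)) • ((((n1 η)⁻¹ : ℝ≥0)) • h (1 + (η : R)))
      rw [Set.indicator_of_mem hsK, hh1, hnprod, NNReal.smul_def, NNReal.smul_def, smul_smul, smul_smul]
      congr 1
      push_cast
      rw [mul_inv, ← mul_assoc, hd]
    · have hbS : (s : R) * (1 + (η : R)) ∉ S := fun hb => hsK (hmem.1 hb)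
      rw [Set.indicator_of_notMem hbS, smul_zero]
      change (0 : E) = (K.indicator (fun p => (dens p.1 : ℝ)) (s, η)) • ψ η
      rw [Set.indicator_of_notMem hsK, zero_smul]
  have hsub : ∀ s : fixedPart σ, IsUnit (s : R) → ∫ y, S.indicator Φ ((s : R) + (y : R)) ∂μm = ∫ η, G (s, η) ∂μm := by
    intro s hs
    rw [integral_eq_skewModulus_smul_integral_comp_smulSkew σ hσc μm hs.unit (hsfix s hs), ← integral_smul]
    exact integral_congr_ae (Filter.Eventually.of_forall fun η => hpt s hs η)
  have hsubL : ∀ s : fixedPart σ, IsUnit (s : R) → ∫⁻ y, ‖S.indicator Φ ((s : R) + (y : R))‖ₑ ∂μm = ∫⁻ η, ‖G (s, η)‖ₑ ∂μm := by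
    intro s hs
    rw [lintegral_eq_skewModulus_mul_lintegral_comp_smulSkew σ hσc μm hs.unit (hsfix s hs), ← lintegral_const_mul' _ _ ENNReal.coe_ne_top]
    refine lintegral_congr fun η => ?_
    rw [← hpt s hs η, enorm_smul, Real.enorm_eq_ofReal (NNReal.coe_nonneg _), ENNReal.ofReal_coe_nnreal]
  -- Step E/F: integrability of `G` (Tonelli through the substitution) and the swap
  have hGint : Integrable G (μp.prod μm) := by
    refine ⟨hGm.aestronglyMeasurable, ?_⟩
    have hF := hintP.hasFiniteIntegral
    unfold HasFiniteIntegral at hF ⊢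
    rw [lintegral_prod _ hGm.aestronglyMeasurable.enorm]
    rw [lintegral_prod _ hintP.aestronglyMeasurable.enorm] at hF
    calc ∫⁻ s, ∫⁻ η, ‖G (s, η)‖ₑ ∂μm ∂μp = ∫⁻ s, ∫⁻ y, ‖S.indicator Φ ((s : R) + (y : R))‖ₑ ∂μm ∂μp :=
          lintegral_congr_ae (hunit.mono fun s hs => (hsubL s hs).symm)
      _ < ⊤ := hF
  have hswap : ∫ s, ∫ η, G (s, η) ∂μm ∂μp = ∫ η, ∫ s, G (s, η) ∂μp ∂μm :=
    integral_integral_swap (by simpa [Function.uncurry_def] using hGint)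
  -- Step G: the inner `s`-integral is the shell mass `V'`, for EVERY `η`
  have hinner : ∀ η : skewPart σ, ∫ s, G (s, η) ∂μp = (ν (T A₀)).toReal • ψ η := by
    intro η
    have hn : (0 : ℝ) < (n1 η : ℝ) := by exact_mod_cast hn1pos η
    have ha : 0 < A / (n1 η : ℝ) := div_pos hA hn
    have hind : ∀ s : fixedPart σ, K.indicator (fun p => (dens p.1 : ℝ)) (s, η) = (T (A / (n1 η : ℝ))).indicator (fun s' => (dens s' : ℝ)) s := by
      intro s
      by_cases hs : s ∈ T (A / (n1 η : ℝ))
      · rw [Set.indicator_of_mem hs, Set.indicator_of_mem (show (s, η) ∈ K from hs)]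
      · rw [Set.indicator_of_notMem hs, Set.indicator_of_notMem (show (s, η) ∉ K from hs)]
    calc ∫ s, G (s, η) ∂μp = ∫ s, (K.indicator (fun p => (dens p.1 : ℝ)) (s, η)) • ψ η ∂μp := rfl
      _ = (∫ s, K.indicator (fun p => (dens p.1 : ℝ)) (s, η) ∂μp) • ψ η := integral_smul_const _ _
      _ = (∫ s in T (A / (n1 η : ℝ)), (dens s : ℝ) ∂μp) • ψ η := by simp_rw [hind]; rw [integral_indicator (hTm _)]
      _ = (ν (T (A / (n1 η : ℝ)))).toReal • ψ η := by
          congr 1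
          rw [integral_eq_lintegral_of_nonneg_ae (Filter.Eventually.of_forall fun s => NNReal.coe_nonneg _)
            ((NNReal.continuous_coe.measurable.comp hdensm).aestronglyMeasurable), hνdef, withDensity_apply _ (hTm _)]
          simp_rw [ENNReal.ofReal_coe_nnreal]
      _ = (ν (T A₀)).toReal • ψ η := by rw [hV _ ha]
  -- Step H: assemble
  rw [hLHS, integral_congr_ae (hunit.mono fun s hs => hsub s hs), hswap]
  simp_rw [hinner]
  exact integral_smul _ _


include hσ hσc hnm hmul hone in
/-- **«THE SKEW-LINE INTEGRAL VANISHES» (MEMO v3 §3 (iii), brick B2): `J_h := ∫_{R⁻} (nrm (1+η))⁻¹ • h (1+η) dμ⁻(η) = 0`** for every measurable bounded `h : R → E` that is invariant under the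
`σ`-FIXED units and picks up a factor `c ≠ 1` under some unit `b₀` — given a `σ`-fixed unit `l₀` of module `> 1`, a `σ`-skew unit `δ`, `1 + R⁻ ⊆ Rˣ`, units of full measure in `R⁺`
and in `R`, and one compact ball `{nrm ≤ A}`.  PROOF: the polar slice (`∫_{annulus} = V' • J_h`, `0 < V' < ∞`) and ★ B2 (ii) (`∫_{annulus} = 0`: the annulus is a fundamental domain for
`l₀^ℤ`, `h` is `l₀`-invariant, `b₀` rescales it by `c ≠ 1`).  USE (road KEYS3-ANALYTIC): `h(b) = χ₁(σ b̂)⁻¹`, `χ₁|_{(R⁺)×} = 1`, `χ₁ ≠ 1` ⇒ `J(χ₁) = 0` — uniformly, no case split.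
CONTROLS: `χ₁ = 1` ⇒ no `b₀` ⇒ excluded; `χ₁|_{F×} = ω` ⇒ `h` NOT fixed-unit-invariant ⇒ excluded (there `J ≠ 0`, as print). [cite: Keys1984, §7 Thm. (1)] [cite: TateThesis1967, §2.4]
[cite: WeilBNT1967, Ch. VII §2] -/
theorem skewLineIntegral_eq_zero_of_eigen_unit
    {𝕜 : Type*} [RCLike 𝕜] {E : Type*} [NormedAddCommGroup E] [NormedSpace ℝ E] [NormedSpace 𝕜 E] [CompleteSpace E] [SecondCountableTopology E]
    [MeasurableSpace E] [BorelSpace E]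
    (δ : Rˣ) (hδ : σ (δ : R) = -δ) (l₀ : Rˣ) (hl₀ : σ (l₀ : R) = l₀) (hQ : 1 < distribHaarChar R l₀)
    (hη : ∀ η : skewPart σ, IsUnit (1 + (η : R))) (hunit : ∀ᵐ s ∂μp, IsUnit ((s : fixedPart σ) : R))
    (hposR : ∀ μ : Measure R, μ.IsAddHaarMeasure → ∀ᵐ b ∂μ, 0 < nrm b)
    {A : ℝ} (hA : 0 < A) (hcpt : IsCompact {b : R | (nrm b : ℝ) ≤ A})
    (h : R → E) (hhm : Measurable h) {C : ℝ} (hhb : ∀ b, ‖h b‖ ≤ C) (hhs : ∀ (s : Rˣ), σ (s : R) = s → ∀ b, h ((s : R) * b) = h b)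
    {b₀ : Rˣ} {c : 𝕜} (hc : c ≠ 1) (hb₀ : ∀ b, h ((b₀ : R) * b) = c • h b) :
    ∫ η, ((nrm (1 + (η : R)))⁻¹ : ℝ≥0) • h (1 + (η : R)) ∂μm = 0 := by
  haveI := locallyCompactSpace_fixedPart σ hσc
  haveI := locallyCompactSpace_skewPart σ hσc
  haveI : SecondCountableTopology (fixedPart σ) := TopologicalSpace.Subtype.secondCountableTopology _
  haveI : SecondCountableTopology (skewPart σ) := TopologicalSpace.Subtype.secondCountableTopology _
  haveI : (μp.prod μm).IsAddHaarMeasure := inferInstance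
  haveI : ((μp.prod μm).map (ringDecomp σ hσ hσc).symm).IsAddHaarMeasure :=
    ContinuousAddEquiv.isAddHaarMeasure_map (μp.prod μm) (ringDecomp σ hσ hσc).symm
  -- the slice: `∫_{annulus} = V' • J`
  have hslice := setIntegral_modulusShell_eq_fixedShellMass_smul_skewLineIntegral σ hσ hσc μp μm hnm hmul hone δ hδ l₀ hl₀ hQ hη hunit hA hcpt hA
    h hhm hhb hhs
  -- the vanishing of the annulus integral (★ B2 (ii))
  have hvan := setIntegral_modulusShell_eq_zero_of_eigen_unit ((μp.prod μm).map (ringDecomp σ hσ hσc).symm) hnm hmul hQ (hposR _ inferInstance) hA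
    h (fun b => hhs l₀ hl₀ b) hc (fun b => hb₀ b)
  rw [hvan] at hslice
  have hV0 := withDensity_fixedShell_ne_zero σ hσ hσc μp hnm hmul hone δ hδ l₀ hl₀ hQ hunit hA
  have hVtop := withDensity_fixedShell_lt_top σ hσc μp hnm l₀ hQ hA hcpt
  have hVr : ((μp.withDensity fun s => ((NNReal.sqrt (nrm (s : R)))⁻¹ : ℝ≥0))
      ((fun s : fixedPart σ => (nrm (s : R) : ℝ)) ⁻¹' Set.Ioc (A / (distribHaarChar R l₀ : ℝ)) A)).toReal ≠ 0 :=
    ENNReal.toReal_ne_zero.2 ⟨hV0, hVtop.ne⟩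
  exact (smul_eq_zero.1 hslice.symm).resolve_left hVr
end Slice

end Summit.HodgeConjecture.HodgeConjecture.Cruxes.H413.F0P3cStCharTSInvolutionRingPolarSlice

end
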